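import Mathlib.Analysis.InnerProductSpace.PiL2
import Mathlib.Analysis.Normed.Affine.Isometry
import Mathlib.Analysis.AperiodicOrder.Delone.Basic
import Mathlib.LinearAlgebra.Basis.Defs
import HarnessLib

/-!
# Multiregular point systems are ideal crystals (Dolbilin–Lagarias–Senechal 1998, Theorem 1.1)

Topic `Literature/Geometry/DiscreteGeometry`. Named fact vendored by a grounder for route
`AtomisticToContinuum/Crystallization/IsometryAtoms`: it grounds the crystallographic half of the
bridge item `Summit.AtomisticToContinuum.Crystallization.Theses.IsometryAtoms.AtomicLawChargesCrystal`
(stmt-AtomisticToContinuum-15778: "Y Delone with finitely many `Sym(Y)`-orbits ⇒ `Y = F + L` with a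
finite motif `F` and a rank-3 lattice `L`"), whose other half (a point-stationary law charging one
rooted isometry class forces finitely many symmetry orbits, by the mass-transport principle) has no
printed counterpart.

## Source (N. P. Dolbilin, J. C. Lagarias, M. Senechal, *Multiregular point systems*, Discrete
Comput. Geom. **20** (1998) 477–498, doi:10.1007/PL00009397; verbatim from pp. 478–479 and 482–483)

* p. 478: "The symmetry group `Sym(X)` of a discrete set `X` is the set of all Euclidean isometries
  of `ℝⁿ` that map `X` to itself. […] An *ideal crystal* or *perfect crystal* is a discrete set `X`
  in `ℝⁿ` which is a finite union of translates of a full-dimensional lattice `L` in `ℝⁿ`."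
* p. 478: "Delone sets, also called Delaunay sets or `(r, R)`-sets, which are those sets `X` in `ℝⁿ`
  that satisfy the two conditions: (i) *Uniform discreteness.* There is an `r > 0` such that any
  open ball of radius `r` in `ℝⁿ` contains at most one point of `X`. (ii) *Relative denseness.*
  There is an `R > 0` such that any closed ball of radius `R` in `ℝⁿ` contains at least one point
  of `X`."
* p. 479: "**Definition 1.1.** A *multiregular point system* is any Delone set `X` such that the
  action of its symmetry group `Sym(X)` partitions the points of `X` into a finite number of orbits."
* p. 479: "**Theorem 1.1.** The following conditions on a set `X` in `ℝⁿ` are equivalent: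
  (i) `X` is a multiregular point system. That is, `X` is a Delone set and the set of isometry
  classes among `{ST_x(X) : x ∈ X}` is finite.
  (ii) `X` is an ideal crystal. That is, `X` is a finite union of translates of an `n`-dimensional
  lattice `L`, with `X = ⋃_{i=1}^k (x_i + L)`.
  (iii) `X` is a discrete set whose symmetry group `Sym(X)` is a crystallographic group.
  The equivalence (ii) ⇔ (iii) is a well-known corollary of Bieberbach's first theorem (see [31,
  Theorem 2]). We give a proof of Theorem 1.1 at the end of Section 2."  (The proof, p. 484, runs
  (i) ⇒ (iii) by criterion (v) of their Theorem 2.1 — a subgroup of `E_n` with one discrete,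
  relatively dense orbit is crystallographic — and (iii) ⇒ (ii) by Bieberbach's first theorem: the
  pure translations of `Sym(X)` form an `n`-dimensional lattice `T`, and `X`, being discrete and
  `T`-invariant, is a finite union of translates of `L = T · 0`.)
* p. 482, (2.1): the Euclidean group `E_n = O(n) ⋉ ℝⁿ` acts by `g · x = Qx + t` — i.e. `E_n` is
  the group of affine isometric self-maps of `ℝⁿ`, Mathlib's `EuclideanSpace ℝ (Fin n) ≃ᵃⁱ[ℝ] _`
  (every isometry of a real normed space onto itself is affine, `IsometryEquiv.toRealAffineIsometryEquiv`).

## Rendering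

* "Delone set" is Mathlib's bundled `Delone.DeloneSet` (a carrier with a positive packing radius
  witnessing `Metric.IsSeparated` and a positive covering radius witnessing `Metric.IsCover … univ`),
  which is conditions (i)–(ii) of p. 478 up to the harmless factor `2` between "an open `r`-ball
  holds at most one point" and "distinct points are `> r` apart".
* "`Sym(X)` partitions `X` into finitely many orbits" is rendered without naming the group: there
  is a finite set `S` of representatives such that every `x ∈ X` is carried into `S` by some
  `g : ℝⁿ ≃ᵃⁱ[ℝ] ℝⁿ` with `g '' X = X` (`HasFinitelyManySymmetryOrbits`).
* "`n`-dimensional lattice" = the `ℤ`-span of a basis of `ℝⁿ` (Mathlib's `ZSpan` normal form of a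
  full lattice), and "finite union of translates" is indexed by a `Finset` of base points
  (`IsIdealCrystal`).
* ONLY the direction (i) ⇒ (ii) is vendored (`DolbilinLagariasSenechal1998_thm1_1`). The literal
  converse fails at the degenerate empty union (`X = ∅` is an "ideal crystal" with `k = 0` but is
  not relatively dense), so the printed equivalence is not restated symbol-for-symbol; (ii) ⇒ (i) for
  nonempty motifs is elementary and not needed downstream.

Deliberately NOT here: Theorem 2.1 (five characterisations of crystallographic groups), the local
criteria Theorems 1.2–1.3, and Bieberbach's theorems themselves (Lagarias, *Point lattices*, in
Graham–Grötschel–Lovász, Handbook of Combinatorics vol. 1, ch. 19, §5, Thms 5.1–5.2).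
-/

namespace Literature.Geometry.DiscreteGeometry

open Metric

/-- `Sym(X)` has finitely many orbits on `X` (Dolbilin–Lagarias–Senechal 1998, Definition 1.1, the
"multiregular" half): there is a finite set `S ⊆ ℝⁿ` of orbit representatives such that every point
`x ∈ X` is mapped into `S` by some Euclidean isometry `g` of `ℝⁿ` with `g(X) = X` (an element of the
symmetry group `Sym(X)`, p. 478). [cite: DolbilinLagariasSenechal1998, Def 1.1] -/
def HasFinitelyManySymmetryOrbits {n : ℕ} (X : Set (EuclideanSpace ℝ (Fin n))) : Prop :=
  ∃ S : Finset (EuclideanSpace ℝ (Fin n)), ∀ x ∈ X,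
    ∃ g : EuclideanSpace ℝ (Fin n) ≃ᵃⁱ[ℝ] EuclideanSpace ℝ (Fin n),
      g '' X = X ∧ g x ∈ (S : Set (EuclideanSpace ℝ (Fin n)))

/-- `X ⊆ ℝⁿ` is an **ideal crystal** (Dolbilin–Lagarias–Senechal 1998, p. 478 and Theorem 1.1 (ii)):
`X = ⋃_{i=1}^k (x_i + L)` is a finite union of translates of an `n`-dimensional lattice `L`, the
lattice being rendered as the `ℤ`-span of a basis `b` of `ℝⁿ` and the base points as a `Finset`.
[cite: DolbilinLagariasSenechal1998, Thm 1.1 (ii)] -/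
def IsIdealCrystal {n : ℕ} (X : Set (EuclideanSpace ℝ (Fin n))) : Prop :=
  ∃ b : Module.Basis (Fin n) ℝ (EuclideanSpace ℝ (Fin n)),
    ∃ F : Finset (EuclideanSpace ℝ (Fin n)),
      X = {y | ∃ x ∈ F, ∃ v ∈ Submodule.span ℤ (Set.range ⇑b), y = x + v}

/-- **Dolbilin–Lagarias–Senechal 1998, Theorem 1.1, (i) ⇒ (ii)** ("multiregular point systems are
ideal crystals"; the equality of the two classes is credited there to Galiulin): if `X ⊆ ℝⁿ` is a
Delone set (Mathlib `Delone.DeloneSet`, conditions (i)–(ii) of p. 478) and its symmetry group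
`Sym(X)` partitions `X` into finitely many orbits, then `X` is a finite union of translates of an
`n`-dimensional lattice: `X = ⋃_{i=1}^k (x_i + L)`. Printed proof: one `Sym(X)`-orbit is discrete
and relatively dense, so `Sym(X)` is crystallographic (their Thm 2.1 (v)); by Bieberbach's first
theorem its pure translations form an `n`-dimensional lattice `T`, and the discrete `T`-invariant
set `X` is a finite union of translates of `T · 0`. Grounds the crystallographic step of
`Summit.AtomisticToContinuum.Crystallization.Theses.IsometryAtoms.AtomicLawChargesCrystal`
(stmt-AtomisticToContinuum-15778). [cite: DolbilinLagariasSenechal1998, Thm 1.1 (i)⇒(ii)] -/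
def DolbilinLagariasSenechal1998_thm1_1 : Prop :=
  ∀ (n : ℕ) (D : Delone.DeloneSet (EuclideanSpace ℝ (Fin n))),
    HasFinitelyManySymmetryOrbits (D : Set (EuclideanSpace ℝ (Fin n))) →
      IsIdealCrystal (D : Set (EuclideanSpace ℝ (Fin n)))

end Literature.Geometry.DiscreteGeometry
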